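import Literature.AnabelianGeometry.EtaleTheta.GalSectDotCCuspOfTrivialisation
import Literature.AnabelianGeometry.EtaleTheta.GalSectThm110iiiVNextKnit
import HarnessLib

/-!
# [EtTh] Thm. 1.10 (iii)'s cusp datum `DotCCusp` FROM AN IDENTIFICATION OF STRUCTURE GROUPS `(K^×)^∧ ≅ Ker(res)` —
# census item C7e, clause (2): the `(K^×)^∧`-torsor IS the genuine `H¹`-torsor of [GalSect] §4 BY CONSTRUCTION

S. Mochizuki, *The étale theta function …* [EtTh], Publ. RIMS **45** (2009), Thm. 1.10 (iii) p. 30 («the `{±1}`-structure … on the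
`(K^×_□)^∧`-torsor at the unique cusp of `Ċ^log_□`») [cite: MochizukiEtTh2009, Thm 1.10 (iii) p.30]; S. Mochizuki, *Galois sections in
absolute anabelian geometry* [GalSect], Nagoya Math. J. **179** (2005), §4 p. 33 («the splittings … form a torsor over
`H¹(G_K, Ẑ(1)) ≅ (K^×)^∧`») [cite: MochizukiGalSect2005, §4 p.33]; K. S. Brown, *Cohomology of Groups*, IV §2 (complements ↔ `H¹`)
[cite: Brown1982CohomologyGroups, Ch. IV §2 Prop. 2.3].

abc-iut cell, layer L2, seat abc-iut-w5-d029 (gen 6); abc-iut-L2-lead RULINGS #35 R404: census item **C7e** «strengthen the torsor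
datum: `eK` … compatible with the Kummer map», after abc-iut-L2-t5's reading (13:15:28Z) that input (d) of this seat's constructor
`DotCCusp.ofTrivialisation` (p447306) — a bare bijection `eK : SplittingClass ≃ (K^×)^∧` — is inhabitable by CARDINALITY and gives the
consumers NOTHING: the END-KNIT closers of EtTh:Thm1.10(iii) (`thm110iiiGalSect_of_Xlevel_v3`, abc-iut-w5-d062 p451194) carry the binder

  (gen)  `∃ κ : (K^×)^∧ ≃* Ker(res : H¹(D, I) → H¹(I, I)),  ∀ k cl, C.torsor.act k cl = (C.pair.torsorDataH1 …).act (κ k) cl`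

(«the cusp torsor IS the genuine `H¹`-torsor of `GalSectSplittingsCohomology` through SOME identification of structure groups»),
and for a generic bijection `eK` NO such `κ` exists (a simply transitive abelian action has trivial centraliser outside itself).

THIS FILE (class (b) CONSTRUCTION over abc-iut-w5-d062's frozen-then-C7 record; no field added, no instance, no `Prop` fact):

* `CuspPair.TorsorData.comapMulEquiv` — change of structure group of a torsor along an isomorphism `A′ ≃* A`;
* `MuTwoSetting.t1Space_GtpC` — `Π^tp_C` is T₁ given a C-level datum (`Π^tp_X` Hausdorff, `inclX` an open embedding);
* **`MuTwoSetting.DotCCusp.IsGenuineTorsor C`** — C7e clause (2) as a class (c) PREDICATE: for every base splitting, the (gen)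
  binder of the v3 closers, VERBATIM;
* **`MuTwoSetting.DotCCusp.ofStructureGroupIso e εZ hx hD hS₀ κ`** — the p447306 constructor with input (d) REPLACED by
  (d′) `κ : (K^×)^∧ ≃* Ker(res)` for the pushed pair `(inclX D_x, inclX I_x)` (a GROUP isomorphism — print's
  «`H¹(G_K, Ẑ(1)) ≅ (K^×)^∧`», i.e. inflation + Kummer theory, is exactly such a datum); `torsor := torsorDataH1` read through `κ`,
  `canonical` / `etaStructure` := the `O_K^×`- / `μ₂(K)`-orbits of the base class; **`isGenuineTorsor_ofStructureGroupIso`: (gen) holds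
  BY CONSTRUCTION for EVERY base splitting** (`torsorDataH1_base_indep`, p434790);
* the instance at abc-iut-L2-t10's commutator-axis Krull carrier: `SettingModel.dotCCuspκ'OfStructureGroupIso`,
  `exists_isGenuineTorsor_inversionModelκ'_of_structureGroupIso`.

HONEST CENSUS of (d′): at `inversionModelκ′` the inertia is CENTRAL, so `Ker(res) = Hom_cont(G_{ℚ_p}, Ẑ)` is torsion-free while
`(ℚ_pˣ)^∧ ∋ η(−1)` has order `2` (abc-iut-w5-d062's `GalSectKxHatTorsion`) — NO `κ` exists there (sequel file); at the `b`-axis carriers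
`DotCCusp` is empty outright (p443644/p445383).  So clause (2), like clause (1) (`GalSectCuspCyclotomicInertia`), has no producer in the
zoo; the joint target is GAP row G-L2t5-1.  Semi-synthetic models are consistency evidence only; nothing of [EtTh]/[GalSect] asserted;
no side taken on [IUTchIII] Cor. 3.12; typed ≠ proved.
-/

noncomputable section

namespace Literature.AnabelianGeometry.EtaleTheta

open Literature.AnabelianGeometry.SemiGraphs GalSect _root_.Topology
open scoped Pointwise

/-! ### §0. Change of structure group along an isomorphism -/

namespace GalSect.CuspPair.TorsorData

variable {G : Type*} [Group G] [TopologicalSpace G] {P : CuspPair G} {A A' : Type*} [Group A] [Group A']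

/-- **Change of structure group along `φ : A′ ≃* A`**: `a′ • c := φ(a′) • c`. [cite: MochizukiGalSect2005, Def 4.1 (i) p.34] -/
def comapMulEquiv (T : P.TorsorData A) (φ : A' ≃* A) : P.TorsorData A' where
  act a c := T.act (φ a) c
  act_one c := by rw [map_one, T.act_one]
  act_mul a b c := by rw [map_mul, T.act_mul]
  existsUnique_act_eq c c' := by
    obtain ⟨a, ha, huniq⟩ := T.existsUnique_act_eq c c'
    refine ⟨φ.symm a, ?_, fun b hb => ?_⟩
    · change T.act (φ (φ.symm a)) c = c'
      rw [MulEquiv.apply_symm_apply]; exact ha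
    · rw [← huniq (φ b) hb, MulEquiv.symm_apply_apply]

/-- [cite: MochizukiGalSect2005, Def 4.1 (i) p.34] -/
@[simp] theorem comapMulEquiv_act (T : P.TorsorData A) (φ : A' ≃* A) (a : A') (c : P.SplittingClass) :
    (T.comapMulEquiv φ).act a c = T.act (φ a) c := rfl

end GalSect.CuspPair.TorsorData

namespace MuTwoSetting

variable {p : ℕ} [Fact p.Prime] (M : MuTwoSetting p)

/-! ### §1. `Π^tp_C` is T₁ (given a C-level datum) -/

/-- `Π^tp_X` is Hausdorff (it injects continuously into the profinite `Π_X`). [cite: MochizukiEtTh2009, §1 p.12] -/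
theorem t2Space_PiTemp : T2Space M.PiTemp :=
  haveI : T2Space M.PiHat := M.isProfiniteCompletion_toHat.t2Space
  T2Space.of_injective_continuous M.toHat_injective M.toHat.continuous

/-- **`Π^tp_C` is T₁** given a C-level datum: `{1} = Π^tp_C ∖ ((Π^tp_C ∖ inclX Π^tp_X) ∪ inclX(Π^tp_X ∖ {1}))` with `inclX(Π^tp_X)` an
open-and-closed subgroup and `inclX` an open map. [cite: MochizukiEtTh2009, Def 1.7 p.27] -/
theorem t1Space_GtpC (e : M.CLevelData) : T1Space M.GtpC := by
  haveI := M.t2Space_PiTemp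
  have hrange : IsClosed (Set.range M.inclX) := (M.isClosedEmbedding_inclX e).isClosed_range
  have himg : IsOpen (M.inclX '' ({1}ᶜ : Set M.PiTemp)) :=
    e.isOpenEmbedding_inclX.isOpenMap _ isOpen_compl_singleton
  have h1 : IsClosed ({1} : Set M.GtpC) := by
    rw [← isOpen_compl_iff]
    have hset : ({1} : Set M.GtpC)ᶜ = (Set.range M.inclX)ᶜ ∪ M.inclX '' ({1}ᶜ : Set M.PiTemp) := by
      ext y
      simp only [Set.mem_compl_iff, Set.mem_singleton_iff, Set.mem_union, Set.mem_range, Set.mem_image, not_exists]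
      constructor
      · intro hy
        by_cases hr : ∃ x, M.inclX x = y
        · obtain ⟨x, rfl⟩ := hr
          exact Or.inr ⟨x, fun hx => hy (by rw [hx, map_one]), rfl⟩
        · exact Or.inl fun x hx => hr ⟨x, hx⟩
      · rintro (h | ⟨x, hx, rfl⟩) hy
        · exact h 1 (by rw [map_one, hy])
        · exact hx (M.injective_inclX (by rw [hy, map_one]))
    rw [hset]
    exact hrange.isOpen_compl.union himg
  exact ⟨fun y => by simpa using (Homeomorph.mulLeft y).isClosedMap _ h1⟩

namespace DotCCusp

variable {M}

/-! ### §2. Clause (2) of C7e as a predicate: the torsor IS the genuine `H¹`-torsor -/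

/-- **C7e, clause (2): the `(K^×)^∧`-torsor of the cusp datum IS the genuine `H¹`-torsor of [GalSect] §4** — for every base
splitting `S₀` of the pair there is an identification of structure groups `κ : (K^×)^∧ ≃* Ker(res : H¹(D, I) → H¹(I, I))` through which
the datum's action is the cohomological translation action `torsorDataH1` (`GalSectSplittingsCohomology`).  This is VERBATIM the
binder (gen) of the END-KNIT closers (`thm110iiiGalSect_of_Xlevel_v3`).  Class (c) predicate over the v2 record.
[cite: MochizukiGalSect2005, §4 p.33] -/
def IsGenuineTorsor [T1Space M.GtpC] {εZ : M.GtpC} (C : M.DotCCusp εZ) : Prop :=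
  ∀ ⦃S₀ : Subgroup M.GtpC⦄ (hS₀ : S₀ ∈ C.pair.splittings),
    haveI := C.isMulCommutative_I
    haveI := C.pair.ID_normal
    ∃ κ : KxHat M.toThetaSetting.toTemperedCurve ≃*
        ↥(ContH1.resKer C.pair.ID (⊤ : Subgroup C.pair.D) (C.pair.isClosedComplement_of_mem_splittings hS₀).le_left),
      ∀ k cl, C.torsor.act k cl = (C.pair.torsorDataH1 C.isClosed_D C.isCompact_I hS₀).act (κ k) cl

/-- ONE base splitting suffices (the genuine torsor does not depend on the base: `torsorDataH1_base_indep`).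
[cite: MochizukiGalSect2005, §4 p.33] -/
theorem isGenuineTorsor_of_exists [T1Space M.GtpC] {εZ : M.GtpC} (C : M.DotCCusp εZ) {S₀ : Subgroup M.GtpC}
    (hS₀ : S₀ ∈ C.pair.splittings)
    (h : haveI := C.isMulCommutative_I
      haveI := C.pair.ID_normal
      ∃ κ : KxHat M.toThetaSetting.toTemperedCurve ≃*
          ↥(ContH1.resKer C.pair.ID (⊤ : Subgroup C.pair.D) (C.pair.isClosedComplement_of_mem_splittings hS₀).le_left),
        ∀ k cl, C.torsor.act k cl = (C.pair.torsorDataH1 C.isClosed_D C.isCompact_I hS₀).act (κ k) cl) :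
    C.IsGenuineTorsor := by
  intro S₁ hS₁
  haveI := C.isMulCommutative_I
  obtain ⟨κ, hκ⟩ := h
  refine ⟨κ, fun k cl => ?_⟩
  rw [hκ k cl, C.pair.torsorDataH1_base_indep C.isClosed_D C.isCompact_I hS₀ hS₁]

/-! ### §3. The constructor: `DotCCusp` from an identification of structure groups -/

variable (e : M.CLevelData) (εZ : M.GtpC) {x : M.Pt} (hx : M.IsCusp x) (hD : M.decomp x ≤ M.GtpXdd)
  {S₀ : Subgroup M.PiTemp} (hS₀ : S₀ ∈ (cuspPairOf M.toTemperedCurve x).splittings)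

include e in
/-- `inclX(D_x)` is closed in `Π^tp_C`. [cite: MochizukiEtTh2009, Def 1.7 p.27] -/
theorem isClosed_pushforward_D : IsClosed ((((cuspPairOf M.toTemperedCurve x).pushforward M.inclX).D : Set M.GtpC)) := by
  change IsClosed ((((M.decomp x).map M.inclX : Subgroup M.GtpC)) : Set M.GtpC)
  rw [Subgroup.coe_map]
  exact (M.isClosedEmbedding_inclX e).isClosedMap _ (M.isClosed_decomp x)

include hx in
/-- `inclX(I_x)` is compact. [cite: MochizukiSemiAnbd2006, §6 p.71] -/
theorem isCompact_pushforward_I : IsCompact ((((cuspPairOf M.toTemperedCurve x).pushforward M.inclX).I : Set M.GtpC)) := by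
  change IsCompact ((((M.inertia x).map M.inclX : Subgroup M.GtpC)) : Set M.GtpC)
  rw [Subgroup.coe_map]
  exact (M.isCompact_inertia hx).image M.continuous_inclX

include e hx in
/-- `inclX(I_x) ≅ Ẑ` is abelian. [cite: MochizukiSemiAnbd2006, §6 p.71] -/
theorem isMulCommutative_pushforward_I : IsMulCommutative ((cuspPairOf M.toTemperedCurve x).pushforward M.inclX).I :=
  ⟨⟨Literature.AnabelianGeometry.AbsoluteAnabelian.ZHatCompletion.mul_comm_of_mulEquiv
    (CuspPair.inertiaEquivPushforward _ M.continuous_inclX (M.isClosedEmbedding_inclX e).isEmbedding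
      (M.inertia_equiv_zHat x hx).some).toMulEquiv⟩⟩

include e hS₀ in
/-- `inclX(S₀)` is a base splitting of the pushed pair. [cite: MochizukiGalSect2005, §4 p.33] -/
theorem map_inclX_mem_splittings : S₀.map M.inclX ∈ ((cuspPairOf M.toTemperedCurve x).pushforward M.inclX).splittings :=
  CuspPair.map_mem_splittings_pushforward _ (M.isClosedEmbedding_inclX e) hS₀

/-- **`DotCCusp` from an identification of structure groups** — the p447306 constructor with its bare trivialisation (d) replaced by
(d′) a GROUP isomorphism `κ : (K^×)^∧ ≃* Ker(res)` onto the structure group of the genuine torsor of the pushed pair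
`(inclX D_x, inclX I_x)`; the torsor field is `torsorDataH1` read through `κ`, so clause (2) holds by construction.  Other inputs as in
p447306: (a) a C-level datum `e`, (b) a cusp `x` with `D_x ≤ Π^tp_Ẍ`, (c) a splitting `S₀` of `(D_x, I_x)`.
[cite: MochizukiEtTh2009, Thm 1.10 (iii) p.30] -/
def ofStructureGroupIso [T1Space M.GtpC]
    (κ : haveI := isMulCommutative_pushforward_I e hx
      haveI := ((cuspPairOf M.toTemperedCurve x).pushforward M.inclX).ID_normal
      KxHat M.toTemperedCurve ≃*
        ↥(ContH1.resKer ((cuspPairOf M.toTemperedCurve x).pushforward M.inclX).ID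
          (⊤ : Subgroup ((cuspPairOf M.toTemperedCurve x).pushforward M.inclX).D)
          (((cuspPairOf M.toTemperedCurve x).pushforward M.inclX).isClosedComplement_of_mem_splittings
            (map_inclX_mem_splittings e hS₀)).le_left)) :
    M.DotCCusp εZ :=
  haveI := isMulCommutative_pushforward_I e hx
  { augC := e.augC.toMonoidHom
    augC_inclX := e.augC_inclX
    pair := (cuspPairOf M.toTemperedCurve x).pushforward M.inclX
    D_le := (Subgroup.map_mono hD).trans ((M.map_GtpXdd_le_dotX εZ).trans (M.dotX_le_dotC εZ))
    I_eq := M.map_inclX_inertia_eq e x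
    cusp := x
    cusp_isCusp := hx
    conj := 1
    D_inf_range := CuspPair.pushforward_D_inf_range _ _
    isClosed_D := isClosed_pushforward_D e
    inertia_equiv_zHat :=
      ⟨CuspPair.inertiaEquivPushforward _ M.continuous_inclX (M.isClosedEmbedding_inclX e).isEmbedding
        (M.inertia_equiv_zHat x hx).some⟩
    torsor := (((cuspPairOf M.toTemperedCurve x).pushforward M.inclX).torsorDataH1 (isClosed_pushforward_D e)
      (isCompact_pushforward_I hx) (map_inclX_mem_splittings e hS₀)).comapMulEquiv κ
    canonical := {c | ∃ b ∈ unitsHat M.toTemperedCurve,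
      c = ((((cuspPairOf M.toTemperedCurve x).pushforward M.inclX).torsorDataH1 (isClosed_pushforward_D e)
        (isCompact_pushforward_I hx) (map_inclX_mem_splittings e hS₀)).comapMulEquiv κ).act b (baseClass e hS₀)}
    canonical_isStructure := ⟨baseClass e hS₀, ⟨1, Subgroup.one_mem _, (CuspPair.TorsorData.act_one _ _).symm⟩, rfl⟩
    etaStructure := {c | ∃ b ∈ (rootsOfUnityK M.toTemperedCurve 2).map (toKxHat M.toTemperedCurve),
      c = ((((cuspPairOf M.toTemperedCurve x).pushforward M.inclX).torsorDataH1 (isClosed_pushforward_D e)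
        (isCompact_pushforward_I hx) (map_inclX_mem_splittings e hS₀)).comapMulEquiv κ).act b (baseClass e hS₀)}
    etaStructure_isStructure := ⟨baseClass e hS₀, ⟨1, Subgroup.one_mem _, (CuspPair.TorsorData.act_one _ _).symm⟩, rfl⟩ }

section

variable [T1Space M.GtpC]
  (κ : haveI := isMulCommutative_pushforward_I e hx
    haveI := ((cuspPairOf M.toTemperedCurve x).pushforward M.inclX).ID_normal
    KxHat M.toTemperedCurve ≃*
      ↥(ContH1.resKer ((cuspPairOf M.toTemperedCurve x).pushforward M.inclX).ID
        (⊤ : Subgroup ((cuspPairOf M.toTemperedCurve x).pushforward M.inclX).D)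
        (((cuspPairOf M.toTemperedCurve x).pushforward M.inclX).isClosedComplement_of_mem_splittings
          (map_inclX_mem_splittings e hS₀)).le_left))

/-- The pair of the constructed datum is `(inclX D_x, inclX I_x)`. [cite: MochizukiEtTh2009, Thm 1.10 (iii) p.30] -/
@[simp] theorem ofStructureGroupIso_pair :
    (ofStructureGroupIso e εZ hx hD hS₀ κ).pair = (cuspPairOf M.toTemperedCurve x).pushforward M.inclX := rfl

/-- **The torsor action of the constructed datum is the genuine `H¹`-action read through `κ`.**
[cite: MochizukiGalSect2005, §4 p.33] -/
theorem ofStructureGroupIso_torsor_act (k : KxHat M.toTemperedCurve)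
    (cl : ((cuspPairOf M.toTemperedCurve x).pushforward M.inclX).SplittingClass) :
    haveI := isMulCommutative_pushforward_I e hx
    (ofStructureGroupIso e εZ hx hD hS₀ κ).torsor.act k cl =
      (((cuspPairOf M.toTemperedCurve x).pushforward M.inclX).torsorDataH1 (isClosed_pushforward_D e)
        (isCompact_pushforward_I hx) (map_inclX_mem_splittings e hS₀)).act (κ k) cl := rfl

/-- **C7e clause (2) HOLDS BY CONSTRUCTION**: the constructed datum's `(K^×)^∧`-torsor IS the genuine `H¹`-torsor (binder (gen) of the
v3 closers, for EVERY base splitting). [cite: MochizukiGalSect2005, §4 p.33] -/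
theorem isGenuineTorsor_ofStructureGroupIso : (ofStructureGroupIso e εZ hx hD hS₀ κ).IsGenuineTorsor :=
  isGenuineTorsor_of_exists _ (map_inclX_mem_splittings e hS₀) ⟨κ, fun _ _ => rfl⟩

include e hx hD hS₀ κ in
/-- Census form: an identification of structure groups yields a `DotCCusp` meeting clause (2). [cite: MochizukiEtTh2009, Thm 1.10 (iii) p.30] -/
theorem exists_isGenuineTorsor_of_structureGroupIso :
    ∃ C : M.DotCCusp εZ, C.IsGenuineTorsor ∧ C.pair = (cuspPairOf M.toTemperedCurve x).pushforward M.inclX :=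
  ⟨ofStructureGroupIso e εZ hx hD hS₀ κ, isGenuineTorsor_ofStructureGroupIso e εZ hx hD hS₀ κ, rfl⟩

end

end DotCCusp

end MuTwoSetting

/-! ### §4. The commutator-axis Krull carrier `inversionModelκ′` -/

namespace SettingModel

open MuTwoSetting

variable (p : ℕ) [Fact p.Prime]

/-- `Π^tp_C` of `inversionModelκ′` is T₁ (C-level datum `cLevelDataInvκ′`). [cite: MochizukiEtTh2009, Def 1.7 p.27] -/
theorem t1Space_GtpC_inversionModelκ' : T1Space (MuTwoSetting.inversionModelκ' p).GtpC :=
  (MuTwoSetting.inversionModelκ' p).t1Space_GtpC (cLevelDataInvκ' p)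

/-- The commutator-axis cusp pair `(D_x, I_x) = (c^Ẑ × G_{ℚ_p}, c^Ẑ)` of `curveκ′` pushed into `Π^tp_C` of `inversionModelκ′`.
[cite: MochizukiEtTh2009, Thm 1.10 (iii) p.30] -/
abbrev pairInvκ' : CuspPair (MuTwoSetting.inversionModelκ' p).GtpC :=
  (cuspPairOf (curveκ' p) ()).pushforward (inclInvκ p)

/-- Its inertia is abelian. [cite: MochizukiSemiAnbd2006, §6 p.71] -/
theorem isMulCommutative_pairInvκ'_I : IsMulCommutative (pairInvκ' p).I :=
  DotCCusp.isMulCommutative_pushforward_I (M := MuTwoSetting.inversionModelκ' p) (cLevelDataInvκ' p) (x := ()) trivial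

/-- The pushed canonical Galois factor is a base splitting of the pushed pair. [cite: MochizukiGalSect2005, §4 p.33] -/
theorem map_inclInvκ_inr_mem_splittings :
    (SemidirectProduct.inr : GQp p →* PiTpκ p).range.map (inclInvκ p) ∈ (pairInvκ' p).splittings :=
  DotCCusp.map_inclX_mem_splittings (M := MuTwoSetting.inversionModelκ' p) (cLevelDataInvκ' p) (inrSplittingκ' p)

/-- **`DotCCusp` at `inversionModelκ′` from an identification of structure groups** `κ : (ℚ_pˣ)^∧ ≃* Ker(res)` for the pushed commutator-axis
pair (every other input a theorem, as in p447306). [cite: MochizukiEtTh2009, Thm 1.10 (iii) p.30] -/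
def dotCCuspκ'OfStructureGroupIso (εZ : (MuTwoSetting.inversionModelκ' p).GtpC)
    (κ : haveI := isMulCommutative_pairInvκ'_I p
      haveI := (pairInvκ' p).ID_normal
      KxHat (curveκ' p) ≃* ↥(ContH1.resKer (pairInvκ' p).ID (⊤ : Subgroup (pairInvκ' p).D)
        ((pairInvκ' p).isClosedComplement_of_mem_splittings (map_inclInvκ_inr_mem_splittings p)).le_left)) :
    (MuTwoSetting.inversionModelκ' p).DotCCusp εZ :=
  haveI := t1Space_GtpC_inversionModelκ' p
  DotCCusp.ofStructureGroupIso (M := MuTwoSetting.inversionModelκ' p) (cLevelDataInvκ' p) εZ (x := ()) trivial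
    (decomp_le_GtpXdd_inversionModelκ' p ()) (inrSplittingκ' p) κ

/-- **Census form (row `DotCCusp`, clause C7e (2)) at `inversionModelκ′`**: an identification `(ℚ_pˣ)^∧ ≃* Ker(res)` of structure groups
for the commutator-axis cusp would yield, for every `ε_Z`, a `DotCCusp` whose torsor IS the genuine `H¹`-torsor.  (The sequel shows no
such identification exists at this untwisted carrier: `Ker(res)` is torsion-free, `(ℚ_pˣ)^∧` is not.) [cite: MochizukiEtTh2009, Thm 1.10 (iii) p.30] -/
theorem exists_isGenuineTorsor_inversionModelκ'_of_structureGroupIso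
    (h : haveI := isMulCommutative_pairInvκ'_I p
      haveI := (pairInvκ' p).ID_normal
      Nonempty (KxHat (curveκ' p) ≃* ↥(ContH1.resKer (pairInvκ' p).ID (⊤ : Subgroup (pairInvκ' p).D)
        ((pairInvκ' p).isClosedComplement_of_mem_splittings (map_inclInvκ_inr_mem_splittings p)).le_left)))
    (εZ : (MuTwoSetting.inversionModelκ' p).GtpC) :
    haveI := t1Space_GtpC_inversionModelκ' p
    ∃ C : (MuTwoSetting.inversionModelκ' p).DotCCusp εZ, C.IsGenuineTorsor :=
  haveI := t1Space_GtpC_inversionModelκ' p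
  ⟨dotCCuspκ'OfStructureGroupIso p εZ h.some,
    DotCCusp.isGenuineTorsor_ofStructureGroupIso (M := MuTwoSetting.inversionModelκ' p) (cLevelDataInvκ' p) εZ
      (x := ()) trivial (decomp_le_GtpXdd_inversionModelκ' p ()) (inrSplittingκ' p) h.some⟩

end SettingModel

end Literature.AnabelianGeometry.EtaleTheta

end
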